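import Mathlib.Data.Matrix.Mul
import Mathlib.Data.Matrix.Basic
import Mathlib.Data.Fin.Tuple.Basic
import Mathlib.Algebra.BigOperators.Fin
import Mathlib.Data.Fintype.BigOperators
import HarnessLib

/-!
# Cyclic transfer matrices: a sum over configurations on a (twisted) cycle of window-3 weights is an entry sum of a power of
# the pair-state transfer matrix (generic layer for ask P-23h (ii), qn-prover-3 g13)

For a finite alphabet `S`, a weight `G : S → S → S → ℤ` on consecutive triples and a boundary twist `σ : S → S`, the cyclic
configuration sum over `V : Fin (n + 2) → S` of `Π_t G(V_{t−1}, V_t, V_{t+1})` — indices mod `n + 2`, except that the two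
wrap-around neighbours are twisted, `V_{−1} := σ(V_{n+1})` and `V_{n+2} := σ(V_0)` — equals

  `Σ_{b c : S} (M^{n+2}) (σ c, b) (c, σ b)`,   `M (u,v) (v',w) := [v = v']·G(u,v,w)`   (`Matrix (S × S) (S × S) ℤ`)

(`sum_cycW_eq`; with `σ = id` this is `tr M^{n+2}`; with `σ` an involution it is the trace against `(u,v) ↦ (σu, σv)`).
Ingredients: the open chain `chain G m a b φ` (left pair fixed, terminal functional `φ`) and its evaluation by matrix powers
(`chain_eq_pow`), the configuration form `pathW` of the open chain (`sum_pathW_eq_chain`, peeling by `Fin.consEquiv`), its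
range-product form (`pathW_eq_prod`), and the decomposition of a cyclic configuration into first letter, middle word and last
letter (`cycW_eq_pathW`).  Used for the folded cycle of the antipodal strategy (`S = Bool × Bool`, `σ` = swap).
WHAT THIS IS NOT: pure bookkeeping; no statement about strategies; separation NOT moved.
-/

namespace Summit.QuantumAdvantage.AdviceFreeQNC0

namespace CyclicTransfer

open Finset Matrix

variable {S : Type} [Fintype S] [DecidableEq S] (G : S → S → S → ℤ)

/-! ### The pair-state transfer matrix and the open chain -/

/-- The pair-state transfer matrix `M (u,v) (v',w) = [v = v']·G(u,v,w)`. -/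
def M : Matrix (S × S) (S × S) ℤ := fun p q => if p.2 = q.1 then G p.1 p.2 q.2 else 0

/-- The open chain of length `m` with left pair `(a, b)` and terminal functional `φ` on the last pair. -/
def chain : ℕ → S → S → (S → S → ℤ) → ℤ
  | 0, a, b, φ => φ a b
  | m + 1, a, b, φ => ∑ s : S, G a b s * chain m b s φ

/-- **The open chain is a matrix power**: `chain m a b φ = Σ_q (M^m) (a,b) q · φ q.1 q.2`. -/
theorem chain_eq_pow : ∀ (m : ℕ) (a b : S) (φ : S → S → ℤ),
    chain G m a b φ = ∑ q : S × S, (M G ^ m) (a, b) q * φ q.1 q.2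
  | 0, a, b, φ => by
      rw [chain, pow_zero, Finset.sum_eq_single (a, b)]
      · rw [Matrix.one_apply_eq, one_mul]
      · intro q _ hq
        rw [Matrix.one_apply_ne (Ne.symm hq), zero_mul]
      · intro h; exact absurd (mem_univ _) h
  | m + 1, a, b, φ => by
      rw [chain]
      have ih := fun s => chain_eq_pow m b s φ
      simp_rw [ih, Finset.mul_sum, pow_succ', Matrix.mul_apply, Finset.sum_mul]
      rw [Finset.sum_comm]
      refine Finset.sum_congr rfl fun q _ => ?_
      have hr : ∑ r : S × S, M G (a, b) r * (M G ^ m) r q * φ q.1 q.2 =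
          ∑ s : S, G a b s * ((M G ^ m) (b, s) q * φ q.1 q.2) := by
        rw [Fintype.sum_prod_type, Finset.sum_eq_single b]
        · refine Finset.sum_congr rfl fun s _ => ?_
          simp [M]
          ring
        · intro u _ hu
          refine Finset.sum_eq_zero fun s _ => ?_
          simp [M, Ne.symm hu]
        · intro h; exact absurd (mem_univ _) h
      rw [hr]

/-- The configuration form of the open chain: consume the word `W` letter by letter. -/
def pathW : (m : ℕ) → S → S → (Fin m → S) → (S → S → ℤ) → ℤ
  | 0, a, b, _, φ => φ a b
  | m + 1, a, b, W, φ => G a b (W 0) * pathW m b (W 0) (Fin.tail W) φ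

omit [DecidableEq S] in
/-- **Summing the configuration form over all words gives the chain.** -/
theorem sum_pathW_eq_chain : ∀ (m : ℕ) (a b : S) (φ : S → S → ℤ),
    ∑ W : Fin m → S, pathW G m a b W φ = chain G m a b φ
  | 0, a, b, φ => by
      rw [chain]
      have hu : (univ : Finset (Fin 0 → S)) = {fun i => i.elim0} := by
        rw [Finset.univ_unique]; exact congrArg _ (Subsingleton.elim _ _)
      rw [hu, Finset.sum_singleton]
      rfl
  | m + 1, a, b, φ => by
      rw [chain, ← Fintype.sum_equiv (Fin.consEquiv fun _ => S) (fun p => pathW G (m + 1) a b (Fin.cons p.1 p.2) φ)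
        (fun W => pathW G (m + 1) a b W φ) (fun p => rfl), Fintype.sum_prod_type]
      refine Finset.sum_congr rfl fun s _ => ?_
      have e : ∀ W : Fin m → S, pathW G (m + 1) a b (Fin.cons s W) φ = G a b s * pathW G m b s W φ := by
        intro W
        simp only [pathW, Fin.cons_zero, Fin.tail_cons]
      simp_rw [e]
      rw [← Finset.mul_sum, sum_pathW_eq_chain m b s φ]

omit [Fintype S] [DecidableEq S] in
/-- **Range-product form of the open chain**: if `E : ℕ → S` lists `a, b, W 0, W 1, …`, then
`pathW m a b W φ = (Π_{i<m} G (E i) (E (i+1)) (E (i+2))) · φ (E m) (E (m+1))`. -/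
theorem pathW_eq_prod : ∀ (m : ℕ) (a b : S) (W : Fin m → S) (φ : S → S → ℤ) (E : ℕ → S),
    E 0 = a → E 1 = b → (∀ i : Fin m, E (i.val + 2) = W i) →
    pathW G m a b W φ = (∏ i ∈ range m, G (E i) (E (i + 1)) (E (i + 2))) * φ (E m) (E (m + 1))
  | 0, a, b, W, φ, E, h0, h1, _ => by
      rw [pathW, Finset.prod_range_zero, one_mul, h0, h1]
  | m + 1, a, b, W, φ, E, h0, h1, h2 => by
      have hW0 : E 2 = W 0 := h2 0
      rw [pathW, pathW_eq_prod m b (W 0) (Fin.tail W) φ (fun i => E (i + 1)) h1 hW0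
        (fun i => by
          show E (i.val + 1 + 2) = W i.succ
          rw [← h2 i.succ]
          simp),
        Finset.prod_range_succ' (fun i => G (E i) (E (i + 1)) (E (i + 2))), h0, h1, hW0]
      ring

/-! ### The twisted cycle -/

variable (σ : S → S) {n : ℕ}

/-- The left neighbour on the twisted cycle: `V_{t−1}`, with `V_{−1} := σ(V_{n+1})`. -/
def prevV (V : Fin (n + 2) → S) (t : Fin (n + 2)) : S :=
  if ht : t.val = 0 then σ (V (Fin.last (n + 1))) else V ⟨t.val - 1, by omega⟩

/-- The right neighbour on the twisted cycle: `V_{t+1}`, with `V_{n+2} := σ(V_0)`. -/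
def nextV (V : Fin (n + 2) → S) (t : Fin (n + 2)) : S :=
  if ht : t.val = n + 1 then σ (V 0) else V ⟨t.val + 1, by omega⟩

/-- The cyclic weight `Π_t G(V_{t−1}, V_t, V_{t+1})` with the twisted wrap-around. -/
def cycW (V : Fin (n + 2) → S) : ℤ := ∏ t : Fin (n + 2), G (prevV σ V t) (V t) (nextV σ V t)

/-- The letter sequence of the cycle read as an open chain: `σ V_{n+1}, V_0, V_1, …, V_{n+1}, σ V_0`. -/
def cycE (V : Fin (n + 2) → S) (i : ℕ) : S :=
  if i = 0 then σ (V (Fin.last (n + 1))) else if h : i - 1 < n + 2 then V ⟨i - 1, h⟩ else σ (V 0)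

/-- The middle word `V_1, …, V_n` of a cyclic configuration. -/
def middle (V : Fin (n + 2) → S) : Fin n → S := fun i => V ⟨i.val + 1, by omega⟩

/-- The terminal functional of the cycle with first letter `b` and last letter `c`: the two triples through `V_{n+1} = c`. -/
def cycPhi (b c : S) : S → S → ℤ := fun u w => G u w c * G w c (σ b)

omit [Fintype S] [DecidableEq S] in
/-- **A cyclic configuration is an open chain** from `(σ V_{n+1}, V_0)` over the middle word, closed by `cycPhi`. -/
theorem cycW_eq_pathW (V : Fin (n + 2) → S) :
    cycW G σ V = pathW G n (σ (V (Fin.last (n + 1)))) (V 0) (middle V) (cycPhi G σ (V 0) (V (Fin.last (n + 1)))) := by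
  have hE : ∀ t : Fin (n + 2), G (prevV σ V t) (V t) (nextV σ V t) =
      G (cycE σ V t.val) (cycE σ V (t.val + 1)) (cycE σ V (t.val + 2)) := by
    intro t
    have ht := t.isLt
    have h1 : prevV σ V t = cycE σ V t.val := by
      unfold prevV cycE
      by_cases h0 : t.val = 0
      · rw [dif_pos h0, if_pos h0]
      · rw [dif_neg h0, if_neg h0, dif_pos (by omega)]
    have h2 : V t = cycE σ V (t.val + 1) := by
      unfold cycE
      rw [if_neg (by omega), dif_pos (by omega)]
      congr 1
    have h3 : nextV σ V t = cycE σ V (t.val + 2) := by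
      unfold nextV cycE
      rw [if_neg (by omega)]
      by_cases h1 : t.val = n + 1
      · rw [dif_pos h1, dif_neg (by omega)]
      · rw [dif_neg h1, dif_pos (by omega)]
        congr 1
    rw [h1, h2, h3]
  unfold cycW
  rw [Finset.prod_congr rfl fun t _ => hE t,
    Fin.prod_univ_eq_prod_range (fun i => G (cycE σ V i) (cycE σ V (i + 1)) (cycE σ V (i + 2))) (n + 2),
    Finset.prod_range_succ, Finset.prod_range_succ,
    pathW_eq_prod G n _ _ (middle V) _ (cycE σ V) (by simp [cycE]) (by simp [cycE])
      (fun i => by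
        unfold cycE middle
        rw [if_neg (by omega), dif_pos (by omega)]
        congr 1)]
  have e1 : cycE σ V (n + 2) = V (Fin.last (n + 1)) := by
    unfold cycE
    rw [if_neg (by omega), dif_pos (by omega)]
    rfl
  have e2 : cycE σ V (n + 1 + 2) = σ (V 0) := by
    unfold cycE
    rw [if_neg (by omega), dif_neg (by omega)]
  rw [e1, e2]
  unfold cycPhi
  ring

/-- Assembling a cyclic configuration from first letter, middle word and last letter. -/
def assemble (p : S × (S × (Fin n → S))) : Fin (n + 2) → S :=
  Fin.cons p.1 (Fin.snoc p.2.2 p.2.1)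

/-- `assemble` is a bijection (it is `Fin.consEquiv` after `Fin.snocEquiv`). -/
def assembleEquiv : S × (S × (Fin n → S)) ≃ (Fin (n + 2) → S) :=
  (Equiv.prodCongr (Equiv.refl S) (Fin.snocEquiv fun _ => S)).trans (Fin.consEquiv fun _ => S)

omit [Fintype S] [DecidableEq S] in
/-- `assembleEquiv` is `assemble`. -/
theorem assembleEquiv_apply (p : S × (S × (Fin n → S))) : assembleEquiv p = assemble p := rfl

omit [Fintype S] [DecidableEq S] in
/-- First letter of an assembled configuration. -/
theorem assemble_zero (p : S × (S × (Fin n → S))) : assemble p 0 = p.1 := by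
  unfold assemble; rw [Fin.cons_zero]

omit [Fintype S] [DecidableEq S] in
/-- Last letter of an assembled configuration. -/
theorem assemble_last (p : S × (S × (Fin n → S))) : assemble p (Fin.last (n + 1)) = p.2.1 := by
  unfold assemble
  rw [← Fin.succ_last, Fin.cons_succ, Fin.snoc_last]

omit [Fintype S] [DecidableEq S] in
/-- Middle word of an assembled configuration. -/
theorem middle_assemble (p : S × (S × (Fin n → S))) : middle (assemble p) = p.2.2 := by
  funext i
  unfold middle assemble
  have e : (⟨i.val + 1, by omega⟩ : Fin (n + 2)) = Fin.succ (Fin.castSucc i) := by ext; simp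
  rw [e, Fin.cons_succ, Fin.snoc_castSucc]

/-- The two closing triples are one more `M²` step: `Σ_q (M^n)(p, q)·G(q.1,q.2,c)·G(q.2,c,d) = (M^{n+2})(p, (c, d))`. -/
theorem sum_pow_mul_close (n : ℕ) (p : S × S) (c d : S) :
    ∑ q : S × S, (M G ^ n) p q * (G q.1 q.2 c * G q.2 c d) = (M G ^ (n + 2)) p (c, d) := by
  rw [pow_add, Matrix.mul_apply]
  refine Finset.sum_congr rfl fun q _ => ?_
  congr 1
  rw [pow_two, Matrix.mul_apply, Finset.sum_eq_single (q.2, c)]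
  · simp [M]
  · intro r _ hr
    simp only [M]
    by_cases h1 : q.2 = r.1
    · by_cases h2 : r.2 = c
      · exfalso; apply hr; ext <;> simp [h1, h2]
      · rw [if_neg h2, mul_zero]
    · rw [if_neg h1, zero_mul]
  · intro h; exact absurd (mem_univ _) h

/-- **The cyclic transfer formula**: `Σ_V cycW V = Σ_{b c} (M^{n+2}) (σ c, b) (c, σ b)`. -/
theorem sum_cycW_eq :
    ∑ V : Fin (n + 2) → S, cycW G σ V = ∑ b : S, ∑ c : S, (M G ^ (n + 2)) (σ c, b) (c, σ b) := by
  rw [← Fintype.sum_equiv assembleEquiv (fun p => cycW G σ (assemble p)) (fun V => cycW G σ V)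
    (fun p => by rw [assembleEquiv_apply]), Fintype.sum_prod_type]
  refine Finset.sum_congr rfl fun b _ => ?_
  rw [Fintype.sum_prod_type]
  refine Finset.sum_congr rfl fun c _ => ?_
  have e : ∀ W : Fin n → S, cycW G σ (assemble (b, c, W)) = pathW G n (σ c) b W (cycPhi G σ b c) := by
    intro W
    rw [cycW_eq_pathW, assemble_zero, assemble_last, middle_assemble]
  simp_rw [e]
  rw [sum_pathW_eq_chain, chain_eq_pow]
  exact sum_pow_mul_close G n (σ c, b) c (σ b)

end CyclicTransfer

end Summit.QuantumAdvantage.AdviceFreeQNC0
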